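import Summits.Ventures.HodgeRepro2.A2LefschetzDecomposition

/-!
# Dual hard Lefschetz: `Λ^{d−n} : ⋀^d → ⋀^{2n−d}` is bijective for `n ≤ d ≤ 2n` (A2 annex, sl₂ — part 4)

The mirror image of row 102's hard Lefschetz theorem for the dual operator `Λ = Σ_p c_p⁻¹ Λ_p`.
Proof: a class `w ∈ ⋀^d`, `d ≥ n`, is `L^{d−n} w'` with `w' ∈ ⋀^{2n−d}` (hard Lefschetz), `w'` has a
Lefschetz decomposition `Σ_j L^j v_j`, and `Λ^{d−n} L^{d−n+j} v_j = c_j L^j v_j` with `c_j ≠ 0`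
(`lam_pow_lef_pow_add_primitive`), so `Λ^{d−n} w = Σ_j c_j L^j v_j` vanishes only if every `v_j`
does (uniqueness of the decomposition); bijectivity follows from `dim ⋀^d = dim ⋀^{2n−d}`.
-/

namespace Summit.Ventures.HodgeRepro2.A2DualHardLefschetz

open WeilPlanes WeilCoproduct A2HardLefschetzOps A2HardLefschetzMain A2LefschetzSplitting
  A2PrimitiveLefschetz A2PrimitivePart A2LefschetzDecomposition

variable {ι : Type*} [DecidableEq ι] [Fintype ι]

/-- The constant of `Λ^m L^{m+j} v = c • L^j v` on a primitive `v` of degree `e`: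
`∏_{i<m} (m+j−i)(n−e−(m+j−i)+1)`. -/
noncomputable def lefConst' (n e m j : ℕ) : ℂ :=
  ∏ i ∈ Finset.range m, (((m + j - i : ℕ) : ℂ) * ((n : ℂ) - e - ((m + j - i : ℕ) : ℂ) + 1))

/-- `lefConst' n e 0 j = 1`. -/
@[simp] lemma lefConst'_zero (n e j : ℕ) : lefConst' n e 0 j = 1 := by simp [lefConst']

/-- The recursion for `lefConst'` (peeling off the innermost `Λ`). -/
lemma lefConst'_succ (n e m j : ℕ) :
    lefConst' n e (m + 1) j =
      ((((m + 1 + j : ℕ) : ℂ) * ((n : ℂ) - e - ((m + 1 + j : ℕ) : ℂ) + 1))) * lefConst' n e m j := by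
  simp only [lefConst', Finset.prod_range_succ']
  rw [mul_comm]
  congr 1
  refine Finset.prod_congr rfl fun i _ => ?_
  rw [show m + 1 + j - (i + 1) = m + j - i by omega]

/-- **`Λ^m L^{m+j}` on a primitive class** `v ∈ ⋀^e`: `Λ^m L^{m+j} v = lefConst' n e m j • L^j v`. -/
theorem lam_pow_lef_pow_add_primitive {c : ι → ℂ} (hc : ∀ p, c p ≠ 0) {e : ℕ} {v : A ι}
    (hv : v ∈ grading ι e) (hprim : lam c v = 0) (j : ℕ) (m : ℕ) :
    (lam c ^ m) ((lef c ^ (m + j)) v) = lefConst' (Fintype.card ι) e m j • (lef c ^ j) v := by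
  induction m with
  | zero => simp
  | succ m ih =>
    have hcoef : ((((m + j : ℕ) : ℂ) + 1) * ((Fintype.card ι : ℂ) - e - ((m + j : ℕ) : ℂ))) *
        lefConst' (Fintype.card ι) e m j = lefConst' (Fintype.card ι) e (m + 1) j := by
      rw [lefConst'_succ]
      push_cast
      ring
    rw [pow_succ (lam c), Module.End.mul_apply, show m + 1 + j = m + j + 1 by omega,
      lam_lef_pow hc hv (m + j), hprim, map_zero, zero_add, map_smul, ih, smul_smul, hcoef]

/-- The constant is non-zero when `e + 2j + m ≤ n` (the degrees of a Lefschetz decomposition of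
`⋀^{2n−d}` with `m = d − n`). -/
lemma lefConst'_ne_zero (n e m j : ℕ) (h : e + 2 * j + m ≤ n) : lefConst' n e m j ≠ 0 := by
  unfold lefConst'
  refine Finset.prod_ne_zero_iff.2 fun i hi => ?_
  have hi' : i < m := Finset.mem_range.1 hi
  have hle : i ≤ m + j := by omega
  refine mul_ne_zero ?_ ?_
  · exact_mod_cast (show m + j - i ≠ 0 by omega)
  · rw [Nat.cast_sub hle]
    have key : ((n : ℂ) - e - (((m + j : ℕ) : ℂ) - (i : ℂ)) + 1) =
        (((n : ℤ) - e - (m + j - i) + 1 : ℤ) : ℂ) := by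
      push_cast
      ring
    rw [key]
    exact_mod_cast (show (n : ℤ) - e - (m + j - i) + 1 ≠ 0 by omega)

/-- **Dual hard Lefschetz, injectivity**: for `n ≤ d ≤ 2n`, `Λ^{d−n}` is injective on `⋀^d`. -/
theorem lam_pow_injective_of_card_le {c : ι → ℂ} (hc : ∀ p, c p ≠ 0) {d : ℕ}
    (hd : Fintype.card ι ≤ d) (hd2 : d ≤ 2 * Fintype.card ι) {w : A ι} (hw : w ∈ grading ι d)
    (h : (lam c ^ (d - Fintype.card ι)) w = 0) : w = 0 := by
  set n := Fintype.card ι with hn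
  -- `w = L^{d−n} w'` with `w' ∈ ⋀^{2n−d}` (hard Lefschetz at degree `2n − d`)
  have hk : 2 * n - d ≤ n := by omega
  have hw' : w ∈ grading ι (2 * n - (2 * n - d)) := by rwa [show 2 * n - (2 * n - d) = d by omega]
  obtain ⟨w', hw'mem, hww'⟩ := (hardLefschetz_bijOn hc hk).2.2 hw'
  simp only at hww'
  rw [show n - (2 * n - d) = d - n by omega] at hww'
  -- the Lefschetz decomposition of `w'`
  obtain ⟨v, hv, hprim, hdec⟩ := exists_lefschetz_decomposition hc (2 * n - d) hk w' hw'mem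
  -- `Λ^{d−n} w = Σ_j c_j • L^j v_j`
  have hsum : (lam c ^ (d - n)) w =
      ∑ j ∈ Finset.range ((2 * n - d) / 2 + 1),
        (lef c ^ j) (lefConst' n (2 * n - d - 2 * j) (d - n) j • v j) := by
    rw [← hww', ← lef_pow_apply, hdec, map_sum, map_sum]
    refine Finset.sum_congr rfl fun j _ => ?_
    rw [← Module.End.mul_apply (lef c ^ (d - n)) (lef c ^ j), ← pow_add,
      lam_pow_lef_pow_add_primitive hc (hv j) (hprim j), map_smul]
  rw [hsum] at h
  -- uniqueness of the decomposition: every `c_j • v_j = 0`, hence every `v_j = 0`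
  have hzero := lefschetz_decomposition_unique hc (2 * n - d) hk
    (fun j => lefConst' n (2 * n - d - 2 * j) (d - n) j • v j)
    (fun j => Submodule.smul_mem _ _ (hv j)) (fun j => by rw [map_smul, hprim j, smul_zero]) h
  have hv0 : ∀ j ≤ (2 * n - d) / 2, v j = 0 := by
    intro j hj
    have hc0 : lefConst' n (2 * n - d - 2 * j) (d - n) j ≠ 0 :=
      lefConst'_ne_zero n _ _ _ (by omega)
    exact (smul_eq_zero.1 (hzero j hj)).resolve_left hc0
  have hw'0 : w' = 0 := by
    rw [hdec]
    refine Finset.sum_eq_zero fun j hj => ?_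
    rw [hv0 j (by have := Finset.mem_range.1 hj; omega), map_zero]
  rw [← hww', hw'0, mul_zero]

/-- `Λ^m` restricted to `⋀^{k+2m} → ⋀^k`. -/
noncomputable def lamPow (c : ι → ℂ) (k m : ℕ) : grading ι (k + 2 * m) →ₗ[ℂ] grading ι k :=
  (lam c ^ m).restrict fun _ hx => lam_pow_mem_grading c m hx

/-- **Dual hard Lefschetz**: for `n ≤ d ≤ 2n`, `Λ^{d−n} : ⋀^d → ⋀^{2n−d}` is bijective
(`d = (2n − d) + 2(d − n)`). -/
theorem dualHardLefschetz_bijective {c : ι → ℂ} (hc : ∀ p, c p ≠ 0) {d : ℕ}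
    (hd : Fintype.card ι ≤ d) (hd2 : d ≤ 2 * Fintype.card ι) :
    Function.Bijective (lamPow c (2 * Fintype.card ι - d) (d - Fintype.card ι)) := by
  have hdeg : 2 * Fintype.card ι - d + 2 * (d - Fintype.card ι) = d := by omega
  have hinj : Function.Injective (lamPow c (2 * Fintype.card ι - d) (d - Fintype.card ι)) := by
    intro x y hxy
    have h := congrArg Subtype.val hxy
    simp only [lamPow, LinearMap.coe_restrict_apply] at h
    have hsub : (lam c ^ (d - Fintype.card ι)) ((x : A ι) - y) = 0 := by
      rw [map_sub, h, sub_self]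
    have hgr : grading ι (2 * Fintype.card ι - d + 2 * (d - Fintype.card ι)) = grading ι d := by
      rw [hdeg]
    have hmem : ((x : A ι) - y) ∈ grading ι d :=
      (congrArg (fun S : Submodule ℂ (A ι) => ((x : A ι) - y) ∈ S) hgr).mp
        (Submodule.sub_mem _ x.2 y.2)
    exact Subtype.ext (sub_eq_zero.1 (lam_pow_injective_of_card_le hc hd hd2 hmem hsub))
  refine ⟨hinj, ?_⟩
  have hfin : Module.finrank ℂ (grading ι (2 * Fintype.card ι - d + 2 * (d - Fintype.card ι))) =
      Module.finrank ℂ (grading ι (2 * Fintype.card ι - d)) := by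
    rw [finrank_grading, finrank_grading, hdeg, Nat.choose_symm hd2]
  exact (LinearMap.injective_iff_surjective_of_finrank_eq_finrank hfin).1 hinj

end Summit.Ventures.HodgeRepro2.A2DualHardLefschetz
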